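import Summits.HodgeConjecture.HodgeConjecture.Theorems.R90S4StableConjOfNormClassesLeTwo   -- ★ p863701 FILE 1 (this seat): `exists_unitary_conj_of_normClasses_le_two`, `isConj_subtype_of_normClasses_le_two`
import Summits.HodgeConjecture.HodgeConjecture.Theorems.R90S4CartanFieldNormIndex          -- ★ FILE 2 (this seat): `normClasses_le_two_of_isField`
import Summits.HodgeConjecture.HodgeConjecture.Theorems.R90S4StableClassCartanType          -- ★ p863391 (K2E3-p12): `IsStablyConjGAt`, `splitFormGL`, `Gqs` frame of (B2-S)
import Summits.HodgeConjecture.HodgeConjecture.Theorems.F0P3cStCharTSCartanFin              -- ★ `onePlace_letters` (the one-place model `U(σ_w, Φ_w)(L_w)`; brings ★ `localNonsplitEquiv`, ★ `AdicCompletionLocalField`)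
import Literature.NumberTheory.Automorphic.QuadraticLocalNormGroupNonsplit                  -- ★ `exists_conjLocal_eq_not_exists_norm` (a NON-NORM `σ`-fixed unit at a non-split place)
import Literature.NumberTheory.Weil1982.UnitaryLocalRingBaseField                           -- ★ `exists_complexConj_eq_neg_ne_zero`, ★ `conjLocal_conjLocal`
import HarnessLib

/-!
# R90-TF · S4 «Ch. 13.1–2», (DICT) sub-brick (3), FILE 3 of 3 — CUBIC CARTAN: STABLE CLASS = CLASS.  At a non-split `v`, a regular semisimple `γ ∈ U(Φ₃)(L⁺_v)` whose Cartan algebra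
# `E_w[γ]` is a FIELD (type (3) of §3.6) has `|𝔇(T∕F)| = 1`: every stably conjugate `γ′` is `U(Φ₃)(L⁺_v)`-conjugate to `γ` (Rogawski 1990, §3.6 p. 31; §3.5 Prop. 3.5.2 p. 29; §12.5 p. 182)

Cell `hodgecm-mathlib`, crux H413 (`stmt-HodgeConjecture-24833`, lane `--supports … --as helper`), route of record `HCCMUnconditional` (no route verbs; count-neutral).
Programme R90-TF, section S4, dealer K2E2-plan (g7): DEALT BY NAME «(DICT) SUB-BRICK (3) CUBIC CARTAN: STABLE CLASS = CLASS → `Theorems/R90S4CubicCartanStableClass.lean`»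
(`R90/STATUS.md` 2026-09-05T00:26:10Z; GO 00:33:17Z; «`E_w[γ]` a field» := `IsField ↥(cartanAlgebra γ.val.val)`, countersign K2E3-p12 (g10)); seat K2E3-p27 (g3).  Third of the
three per-type inputs of the (DICT) letter behind the stable regrouping (B2-S) (K2E3-p12 (g10) census `CENSUS-S1-DTF-per-Cartan-type` row (3)).  THEOREMS ONLY — no `def`, no
instance, no notation, no `sorry`; ★-only imports.

## THE MATHEMATICS
`G_v = U(Φ₃)(L⁺_v) = Gqs L v` at a NON-SPLIT place `v` (one place `w ∣ v`, `E_w = L_w` a field with conjugation `σ_w` over `F_v = L⁺_v`).  By ★ FILE 1 (the odd-degree trick,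
`exists_unitary_conj_of_normClasses_le_two`) the stable class of a regular `γ` is ONE conjugacy class as soon as (NI) the `⋆`-fixed units of the Cartan algebra `Z(γ)` have at most two
classes modulo `⋆`-norms and a `σ`-fixed NON-NORM scalar exists; the latter holds at every non-split place (★ `exists_conjLocal_eq_not_exists_norm`, the local norm index of `E_w∕F_v`
is `2`) — this is §1, **`isConj_of_isStablyConjGAt_of_normClasses_le_two`**, hypothesis-first over the letter (NI) in `Gqs` currency.  When `Z(γ)` is a FIELD — type (3) of
[§3.6]: `Z(γ) = K₃·E_w` for a cubic field `K₃ ∕ F_v`, `T = Z_G(γ) ≅ K¹₃E`, `r′ = 1` — (NI) is ★ FILE 2 `normClasses_le_two_of_isField` (the local norm index of `Z(γ) ∕ K₃` is `2`: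
any finite extension of `E_w` is a local field, Mathlib's spectral norm + ★ B-typ04 `LocalFieldInvolutionNorm`), read in the ONE-PLACE MODEL `U(σ_w, Φ_w)(L_w)` (★
`localNonsplitEquiv`, ★ `onePlace_letters`: `σ_w² = 1`, `σ_w ≠ 1`, `Φ_w` hermitian invertible; `E_w = w.adicCompletion L` is a Mathlib normed field and a ★ local field).  Hence
§2, **`isConj_of_isStablyConjGAt_of_isField_cartanAlgebra`**: `γ ∼_{st} γ′ ⇒ γ ∼_{G_v} γ′` — «`|𝔇(T∕F)| = 2^{r′−1} = 1`» for the cubic tori [§3.6 p. 31], the (DICT) transport family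
at a type-(3) member of the Cartan system is `{id}` and `Φ^{st}(γ, f) = Φ(γ, f)` there.

## CONTENTS (`v` non-split throughout)
* §1 `isConj_of_isStablyConjGAt_of_normClasses_le_two` — hypothesis-first over (NI) (letter text = ★ FILE 1's `hNI` at `σ := conjLocal`, `H := cmLocalForm L 3 v`).
* §2 `isField_cartanAlgebra_localNonsplitEquiv` (the field hypothesis in the one-place model), **`isConj_of_isStablyConjGAt_of_isField_cartanAlgebra`** (the dealt target),
  `isStablyConjGAt_iff_isConj_of_isField_cartanAlgebra`.

HONEST LABEL: HC_CM is proved only modulo the 7 printed citations (2 remaining named inputs: hLiu418 = stmt-HodgeConjecture-24832, h413 = stmt-HodgeConjecture-24833) until rung 0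
closes.  One of three per-type inputs of one letter behind (B2-S) behind (W-NP); discharges no named input; (W-NP) ∕ (1D-CT)_ns OPEN.  REL ≠ ★ ≠ BUILT.

## References
* [Rogawski1990] J. D. Rogawski, *Automorphic Representations of Unitary Groups in Three Variables*, Ann. of Math. Stud. 123 (1990), §3.1 p. 19, §3.5 Prop. 3.5.2 p. 29, §3.6 p. 31
  (type (3), `|𝔇(T∕F)| = 1`), §12.5 p. 182.
* [Kottwitz1986] R. E. Kottwitz, *Stable trace formula: elliptic singular terms*, Math. Ann. 275 (1986), §7.
* [Serre1979] J.-P. Serre, *Local Fields*, GTM 67 (1979), Ch. XIV §2 (local norm index).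
-/

set_option autoImplicit false
set_option linter.dupNamespace false

noncomputable section

open NumberField IsDedekindDomain Polynomial
open scoped Matrix MatrixGroups Valued
open Literature.NumberTheory.Rogawski1990 Literature.NumberTheory.Automorphic Literature.NumberTheory.Automorphic.UnitaryGroup
open Literature.NumberTheory.GaloisRepresentations Literature.NumberTheory.LocalFields
open Literature.AlgebraicGeometry.ShimuraVarieties (unitaryGroup mem_unitaryGroup_iff)
open Literature.NumberTheory.Rogawski1990.TypeThreeTorus (isRegularElt_iff_separable_localNonsplitEquiv)
open Summit.HodgeConjecture.HodgeConjecture.Cruxes.H413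
open Summit.HodgeConjecture.HodgeConjecture.Cruxes.H413.F0P3cStCharTSCartanFin (onePlace_letters)

namespace Summit.HodgeConjecture.HodgeConjecture.R90.S4

section NonSplit

variable (L : Type) [Field L] [NumberField L] [IsCMField L] (v : HeightOneSpectrum (𝓞 ↥(maximalRealSubfield L)))

/-! ## §1 Hypothesis-first: stable class = class over the letter (NI), in `Gqs` currency -/

variable {L v} in
/-- **STABLE CLASS = CLASS OVER THE TWO-CLASS LETTER (NI)** at a non-split `v`.  `γ, γ′ ∈ Gqs L v = U(Φ₃)(L⁺_v)`, `γ` regular; (NI): any two `⋆`-fixed units `x, y` of the Cartan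
algebra `Z(γ) ⊆ M₃(L ⊗ L⁺_v)` (★ `cartanAlgebra`, `⋆ = hermStar (c ⊗ 1) Φ₃`) that are NOT killed by a `⋆`-norm `t⋆t` (`t ∈ Z(γ)` invertible) satisfy `y = x·(t⋆t)`.  Then
`γ ∼_{st} γ′` (★ `IsStablyConjGAt`) implies `γ ∼ γ′` in `Gqs L v`: ★ FILE 1 `exists_unitary_conj_of_normClasses_le_two` over the FIELD `L ⊗ L⁺_v = L_w` (★ `LocalRing.isField_of_smul_eq`)
with the ★ non-norm `σ`-fixed unit of `exists_conjLocal_eq_not_exists_norm` as `r₀`. [cite: Rogawski1990, §3.1 p. 19; §3.5 Prop. 3.5.2 p. 29; §3.6 p. 31] [cite: Kottwitz1986, §7] -/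
theorem isConj_of_isStablyConjGAt_of_normClasses_le_two (hns : ∀ w : PlacesOver L v, IsCMField.complexConj L • w.1 = w.1) {γ γ' : Gqs L v}
    (hreg : IsRegularElt (γ.val : GL (Fin 3) (LocalRing L v)))
    (hNI : ∀ x y : Matrix (Fin 3) (Fin 3) (LocalRing L v),
      x ∈ cartanAlgebra (γ.val.val : Matrix (Fin 3) (Fin 3) (LocalRing L v)) →
      y ∈ cartanAlgebra (γ.val.val : Matrix (Fin 3) (Fin 3) (LocalRing L v)) →
      hermStar (conjLocal L (IsCMField.complexConj L) v) (cmLocalForm L 3 v) x = x → hermStar (conjLocal L (IsCMField.complexConj L) v) (cmLocalForm L 3 v) y = y →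
      IsUnit x.det → IsUnit y.det →
      (¬ ∃ t : GL (Fin 3) (LocalRing L v), (t.val : Matrix (Fin 3) (Fin 3) (LocalRing L v)) ∈ cartanAlgebra (γ.val.val : Matrix (Fin 3) (Fin 3) (LocalRing L v)) ∧
          x * (hermStar (conjLocal L (IsCMField.complexConj L) v) (cmLocalForm L 3 v) t.val * t.val) = 1) →
      (¬ ∃ t : GL (Fin 3) (LocalRing L v), (t.val : Matrix (Fin 3) (Fin 3) (LocalRing L v)) ∈ cartanAlgebra (γ.val.val : Matrix (Fin 3) (Fin 3) (LocalRing L v)) ∧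
          y * (hermStar (conjLocal L (IsCMField.complexConj L) v) (cmLocalForm L 3 v) t.val * t.val) = 1) →
      ∃ t : GL (Fin 3) (LocalRing L v), (t.val : Matrix (Fin 3) (Fin 3) (LocalRing L v)) ∈ cartanAlgebra (γ.val.val : Matrix (Fin 3) (Fin 3) (LocalRing L v)) ∧
          y = x * (hermStar (conjLocal L (IsCMField.complexConj L) v) (cmLocalForm L 3 v) t.val * t.val))
    (h : IsStablyConjGAt L (splitFormGL L) v γ γ') : IsConj γ γ' := by
  obtain ⟨w⟩ := (inferInstance : Nonempty (PlacesOver L v))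
  have hw := hns w
  letI : Field (LocalRing L v) := (LocalRing.isField_of_smul_eq (IsCMField.complexConj L) (IsCMField.complexConj_ne_one L) w hw).toField
  -- the letters of the quasi-split local form
  have hH : IsUnit (cmLocalForm L 3 v).det := by
    rw [cmLocalForm_eq_over]
    exact (Matrix.isUnit_iff_isUnit_det _).1 ((StdForm.antidiagonal 3).isUnit_over _)
  have hHh : ((cmLocalForm L 3 v).map (conjLocal L (IsCMField.complexConj L) v))ᵀ = cmLocalForm L 3 v := by
    rw [cmLocalForm_eq_over, StdForm.over_map, StdForm.transpose_over]
  have hσ : ∀ r : LocalRing L v, conjLocal L (IsCMField.complexConj L) v (conjLocal L (IsCMField.complexConj L) v r) = r :=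
    Literature.NumberTheory.Weil1982.UnitaryFinTopForm.conjLocal_conjLocal L v
  -- a non-norm `σ`-fixed unit
  obtain ⟨δ, hcδ, hδ⟩ := Literature.NumberTheory.Weil1982.UnitaryFinTopForm.exists_complexConj_eq_neg_ne_zero L
  obtain ⟨r₀, hr₀σ, hr₀u, hr₀n⟩ := exists_conjLocal_eq_not_exists_norm L v (IsCMField.complexConj L) hcδ hδ w hw
  have hr₀n' : ∀ z : LocalRing L v, z * conjLocal L (IsCMField.complexConj L) v z ≠ r₀ := by
    intro z hz
    refine hr₀n ⟨z, ?_, by rw [← hz, mul_comm]⟩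
    rw [← hz] at hr₀u
    exact isUnit_of_mul_isUnit_left hr₀u
  -- the two renderings of `U(Φ₃)(L⁺_v)`
  have hUU : unitaryGroupOfForm (conjLocal L (IsCMField.complexConj L) v) (cmLocalForm L 3 v) =
      unitaryGroup (conjLocal L (IsCMField.complexConj L) v) (cmLocalForm L 3 v) := Subgroup.ext fun _ => Iff.rfl
  let γ₁ : ↥(unitaryGroup (conjLocal L (IsCMField.complexConj L) v) (cmLocalForm L 3 v)) := ⟨γ.val, by rw [← hUU]; exact γ.2⟩
  let γ₁' : ↥(unitaryGroup (conjLocal L (IsCMField.complexConj L) v) (cmLocalForm L 3 v)) := ⟨γ'.val, by rw [← hUU]; exact γ'.2⟩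
  have h₁ : IsConj (γ₁ : GL (Fin 3) (LocalRing L v)) (γ₁' : GL (Fin 3) (LocalRing L v)) := h
  obtain ⟨g, hg⟩ := isConj_iff.1 h₁
  obtain ⟨u, hu, huc⟩ := exists_unitary_conj_of_normClasses_le_two (conjLocal L (IsCMField.complexConj L) v) hH hσ hHh hr₀σ hr₀n'
    (γ := γ₁) (δ := γ₁') hreg hNI hg
  have hu' : u ∈ unitaryGroupOfForm (conjLocal L (IsCMField.complexConj L) v) (cmLocalForm L 3 v) := by rw [hUU]; exact hu
  refine isConj_iff.2 ⟨⟨u, hu'⟩, ?_⟩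
  apply Subtype.ext
  exact huc

/-! ## §2 Cubic Cartan (the Cartan algebra is a field): stable class = class -/

variable {L v} in
/-- **The field hypothesis in the one-place model**: if `Z(γ) ⊆ M₃(L ⊗ L⁺_v)` is a field then so is the Cartan algebra `Z(γ_w) ⊆ M₃(L_w)` of the one-place image `γ_w` (★
`localNonsplitEquiv`; evaluation at the unique `w ∣ v` is a ring isomorphism `L ⊗ L⁺_v ≃ L_w`, inducing `Z(γ) ≃+* Z(γ_w)`). [cite: Rogawski1990, §3.1 p. 19] [cite: PlatonovRapinchuk1994, §5.1] -/
theorem isField_cartanAlgebra_localNonsplitEquiv (w : PlacesOver L v) (hw : IsCMField.complexConj L • w.1 = w.1) {γ : Gqs L v}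
    (hfield : IsField ↥(cartanAlgebra (γ.val.val : Matrix (Fin 3) (Fin 3) (LocalRing L v)))) :
    IsField ↥(cartanAlgebra (((localNonsplitEquiv (IsCMField.complexConj L) (qsForm L) (IsCMField.complexConj_ne_one L) w hw γ :
        ↥(unitaryGroupOfForm (galAdicCompletionMap (L := L) (IsCMField.complexConj L) hw) (placeForm (qsForm L) w.1))) :
        GL (Fin 3) (w.1.adicCompletion L)) : Matrix (Fin 3) (Fin 3) (w.1.adicCompletion L))) := by
  letI : Unique (PlacesOver L v) :=
    @uniqueOfSubsingleton _ (PlacesOver.subsingleton_of_smul_eq (IsCMField.complexConj L) (IsCMField.complexConj_ne_one L) w hw) w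
  let ψ : LocalRing L v ≃+* w.1.adicCompletion L := RingEquiv.piUnique fun w' : PlacesOver L v => w'.1.adicCompletion L
  set γm : Matrix (Fin 3) (Fin 3) (LocalRing L v) := (γ.val.val : Matrix (Fin 3) (Fin 3) (LocalRing L v)) with hγm
  set γm₁ : Matrix (Fin 3) (Fin 3) (w.1.adicCompletion L) :=
    (((localNonsplitEquiv (IsCMField.complexConj L) (qsForm L) (IsCMField.complexConj_ne_one L) w hw γ :
        ↥(unitaryGroupOfForm (galAdicCompletionMap (L := L) (IsCMField.complexConj L) hw) (placeForm (qsForm L) w.1))) :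
        GL (Fin 3) (w.1.adicCompletion L)) : Matrix (Fin 3) (Fin 3) (w.1.adicCompletion L)) with hγm₁
  have hmap : ψ.mapMatrix γm = γm₁ := rfl
  -- the induced ring isomorphism of Cartan algebras
  have hto : ∀ a : Matrix (Fin 3) (Fin 3) (LocalRing L v), a ∈ cartanAlgebra γm → ψ.mapMatrix a ∈ cartanAlgebra γm₁ := by
    intro a ha
    rw [mem_cartanAlgebra_iff] at ha ⊢
    rw [← hmap]
    exact ha.map ψ.mapMatrix
  have hfrom : ∀ b : Matrix (Fin 3) (Fin 3) (w.1.adicCompletion L), b ∈ cartanAlgebra γm₁ → ψ.mapMatrix.symm b ∈ cartanAlgebra γm := by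
    intro b hb
    rw [mem_cartanAlgebra_iff] at hb ⊢
    have h := hb.map ψ.mapMatrix.symm
    rwa [← hmap, RingEquiv.symm_apply_apply] at h
  let e : ↥(cartanAlgebra γm) ≃* ↥(cartanAlgebra γm₁) :=
    { toFun := fun a => ⟨ψ.mapMatrix a.1, hto _ a.2⟩
      invFun := fun b => ⟨ψ.mapMatrix.symm b.1, hfrom _ b.2⟩
      left_inv := fun a => Subtype.ext (RingEquiv.symm_apply_apply _ _)
      right_inv := fun b => Subtype.ext (RingEquiv.apply_symm_apply _ _)
      map_mul' := fun a b => Subtype.ext (map_mul ψ.mapMatrix _ _) }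
  exact MulEquiv.isField hfield e.symm

variable {L v} in
/-- **CUBIC CARTAN: STABLE CLASS = CLASS** — (DICT) sub-brick (3).  `v` non-split; `γ ∈ Gqs L v = U(Φ₃)(L⁺_v)` regular semisimple whose Cartan algebra `E_w[γ] = Z(γ)` (★
`cartanAlgebra`) is a FIELD (type (3) of §3.6: `T = Z_G(γ) ≅ K₃¹` for a cubic field `K₃ ∕ L⁺_v`); then every `γ′ ∈ Gqs L v` stably conjugate to `γ` (★ `IsStablyConjGAt`, conjugacy in
`GL₃(L ⊗ L⁺_v)`) is conjugate to `γ` IN `Gqs L v` — `|𝔇(T∕F)| = 2^{r′−1} = 1`.  Proof in the one-place model `U(σ_w, Φ_w)(L_w)` (★ `localNonsplitEquiv`, ★ `onePlace_letters`):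
★ FILE 1 `isConj_subtype_of_normClasses_le_two` with the letter (NI) := ★ FILE 2 `normClasses_le_two_of_isField` (local norm index of `Z(γ) ∕ Z(γ)^⋆`) and the non-norm scalar of ★
`LocalFieldInvolutionNorm.exists_fixed_nonnorm_dichotomy` (local norm index of `E_w ∕ F_v`). [cite: Rogawski1990, §3.6 p. 31; §3.5 Prop. 3.5.2 p. 29; §12.5 p. 182] [cite: Kottwitz1986, §7]
[cite: Serre1979, Ch. XIV §2] -/
theorem isConj_of_isStablyConjGAt_of_isField_cartanAlgebra (hns : ∀ w : PlacesOver L v, IsCMField.complexConj L • w.1 = w.1) {γ γ' : Gqs L v}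
    (hreg : IsRegularElt (γ.val : GL (Fin 3) (LocalRing L v)))
    (hfield : IsField ↥(cartanAlgebra (γ.val.val : Matrix (Fin 3) (Fin 3) (LocalRing L v))))
    (h : IsStablyConjGAt L (splitFormGL L) v γ γ') : IsConj γ γ' := by
  obtain ⟨w⟩ := (inferInstance : Nonempty (PlacesOver L v))
  have hw := hns w
  obtain ⟨-, hσσ, -, -, hex, hHdet, hH⟩ := onePlace_letters L w hw
  -- the one-place model and the two renderings of `U(σ_w, Φ_w)(L_w)`
  let e₁ := localNonsplitEquiv (IsCMField.complexConj L) (qsForm L) (IsCMField.complexConj_ne_one L) w hw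
  have hUU : unitaryGroupOfForm (galAdicCompletionMap (L := L) (IsCMField.complexConj L) hw) (placeForm (qsForm L) w.1) =
      unitaryGroup (galAdicCompletionMap (L := L) (IsCMField.complexConj L) hw) (placeForm (qsForm L) w.1) := Subgroup.ext fun _ => Iff.rfl
  let e : Gqs L v ≃* ↥(unitaryGroup (galAdicCompletionMap (L := L) (IsCMField.complexConj L) hw) (placeForm (qsForm L) w.1)) :=
    e₁.toMulEquiv.trans (MulEquiv.subgroupCongr hUU)
  have hecoe : ∀ x : Gqs L v, ((e x : ↥(unitaryGroup (galAdicCompletionMap (L := L) (IsCMField.complexConj L) hw) (placeForm (qsForm L) w.1))) :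
      GL (Fin 3) (w.1.adicCompletion L)) =
      ((e₁ x : ↥(unitaryGroupOfForm (galAdicCompletionMap (L := L) (IsCMField.complexConj L) hw) (placeForm (qsForm L) w.1))) : GL (Fin 3) (w.1.adicCompletion L)) :=
    fun _ => rfl
  -- stable conjugacy read in the model: `GL₃(L_w)`-conjugacy (the evaluation homomorphism)
  let Ψ : GL (Fin 3) (LocalRing L v) →* GL (Fin 3) (w.1.adicCompletion L) :=
    Units.map (RingHom.mapMatrix (Pi.evalRingHom (fun w' : PlacesOver L v => w'.1.adicCompletion L) w)).toMonoidHom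
  have hΨ : ∀ x : Gqs L v, Ψ x.val =
      ((e₁ x : ↥(unitaryGroupOfForm (galAdicCompletionMap (L := L) (IsCMField.complexConj L) hw) (placeForm (qsForm L) w.1))) : GL (Fin 3) (w.1.adicCompletion L)) :=
    fun x => Units.ext rfl
  have h0 : IsConj (γ.val : GL (Fin 3) (LocalRing L v)) γ'.val := h
  have h1 : IsConj ((e γ : ↥(unitaryGroup (galAdicCompletionMap (L := L) (IsCMField.complexConj L) hw) (placeForm (qsForm L) w.1))) : GL (Fin 3) (w.1.adicCompletion L))
      ((e γ' : ↥(unitaryGroup (galAdicCompletionMap (L := L) (IsCMField.complexConj L) hw) (placeForm (qsForm L) w.1))) : GL (Fin 3) (w.1.adicCompletion L)) := by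
    rw [hecoe, hecoe, ← hΨ, ← hΨ]
    exact Ψ.map_isConj h0
  -- regularity and the field hypothesis in the model
  have hsep : (((e γ : ↥(unitaryGroup (galAdicCompletionMap (L := L) (IsCMField.complexConj L) hw) (placeForm (qsForm L) w.1))) : GL (Fin 3) (w.1.adicCompletion L)) :
      Matrix (Fin 3) (Fin 3) (w.1.adicCompletion L)).charpoly.Separable := by
    rw [hecoe]
    exact (isRegularElt_iff_separable_localNonsplitEquiv L w hw γ).1 hreg
  have hfield₁ := isField_cartanAlgebra_localNonsplitEquiv w hw (γ := γ) hfield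
  rw [← hecoe] at hfield₁
  -- `σ_w ≠ id` and a non-norm `σ_w`-fixed scalar (local norm index of `E_w ∕ F_v`)
  have hσ1 : galAdicCompletionMap (L := L) (IsCMField.complexConj L) hw ≠ RingHom.id (w.1.adicCompletion L) := by
    obtain ⟨ℓ, hℓ⟩ := hex
    intro hid
    exact hℓ (by simpa using DFunLike.congr_fun hid ℓ)
  obtain ⟨r₀, hr₀σ, -, hr₀n, -⟩ :=
    LocalFieldInvolutionNorm.exists_fixed_nonnorm_dichotomy (galAdicCompletionMap (L := L) (IsCMField.complexConj L) hw) hσσ hσ1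
  -- (NI) for the field Cartan algebra, then the odd-degree trick
  have hNI := normClasses_le_two_of_isField (galAdicCompletionMap (L := L) (IsCMField.complexConj L) hw) (n := Fin 3) hHdet hσσ hH hex
    (γ := ((e γ : ↥(unitaryGroup (galAdicCompletionMap (L := L) (IsCMField.complexConj L) hw) (placeForm (qsForm L) w.1))) : GL (Fin 3) (w.1.adicCompletion L)))
    (e γ).2 hsep hfield₁
  have h2 : IsConj (e γ) (e γ') :=
    isConj_subtype_of_normClasses_le_two (galAdicCompletionMap (L := L) (IsCMField.complexConj L) hw) hHdet hσσ hH hr₀σ hr₀n hsep hNI h1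
  have h3 := e.symm.toMonoidHom.map_isConj h2
  simpa only [MulEquiv.coe_toMonoidHom, MulEquiv.symm_apply_apply] using h3

variable {L v} in
/-- **On a cubic Cartan: stable class ⟺ class** (`v` non-split, `γ` regular with field Cartan algebra). [cite: Rogawski1990, §3.6 p. 31; §12.5 p. 182] -/
theorem isStablyConjGAt_iff_isConj_of_isField_cartanAlgebra (hns : ∀ w : PlacesOver L v, IsCMField.complexConj L • w.1 = w.1) {γ γ' : Gqs L v}
    (hreg : IsRegularElt (γ.val : GL (Fin 3) (LocalRing L v)))
    (hfield : IsField ↥(cartanAlgebra (γ.val.val : Matrix (Fin 3) (Fin 3) (LocalRing L v)))) :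
    IsStablyConjGAt L (splitFormGL L) v γ γ' ↔ IsConj γ γ' := by
  refine ⟨isConj_of_isStablyConjGAt_of_isField_cartanAlgebra hns hreg hfield, fun h => ?_⟩
  obtain ⟨c, hc⟩ := isConj_iff.1 h
  refine isConj_iff.2 ⟨c.val, ?_⟩
  rw [← hc]
  rfl

end NonSplit

end Summit.HodgeConjecture.HodgeConjecture.R90.S4

end
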